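import Literature.GroupTheory.SpecificGroups.PadicQuadraticAffineLevel
import Literature.AnabelianGeometry.SemiGraphs.ArithMaximalCompactTrivialBase
import HarnessLib

/-!
# [SemiAnbd] Thm 5.4 — the binders `{hest, branch transport, noSwitchBase, non-split}` are JOINTLY
# INHABITED at a carrier WITH AN EDGE: the quadratic affine witness `ℤ_p[√p] ⋊ (U_ℝ × U)`

Mochizuki, *Semi-graphs of anabelioids*, Publ. RIMS **42** (2006) 221–322, §5: Def 5.1 (i) p. 62 (the
arithmetic action transports the decomposition groups; «does not switch the branches»), Def 5.3 (i)/(ii)/(iii)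
p. 65, Rmk 5.3.1 p. 65, Thm 5.4 p. 66 (hypothesis «totally arithmetically estranged»), Ex 5.6 p. 67.
[cite: MochizukiSemiAnbd2006, Def 5.3 (ii), p. 65]

PROOF-ONLY file (cell abc-iut, layer L3; row «NV-T54-RESIDUAL stage 1» = abc-iut-L3-lead gen 7 γ56 (4), seat
abc-iut-w6-d099 gen 6; DESIGN CREDIT abc-iut-w4-d029 gen 6 HANDOFF #2: «vertex group pℤ_p² ⋊ (1+pℤ_p), Π_A =
Gaussian 1-units on ℤ_p[i], p ≡ 3 (4): no ℚ_p-eigenvectors ⇒ branch-stabiliser intersections have image the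
real 1-units, closed non-open ⇒ hest; kernel of the outer action = U_ℝ non-open ⇒ non-split», realised with the
ramified twin `R = ℤ_p[√p]` — the mechanism is only «`R` is a DOMAIN of rank two over `ℤ_p`», which `√p` gives
for every prime — over the carrier `Literature/GroupTheory/SpecificGroups/PadicQuadratic{OneUnits,AffineGroup,
AffineLevel}.lean`).  No definition, no instance, no new named fact; abc-iut-L3-t3's typed predicates
(`ArithMaximalCompact.lean`, DEFS-FROZEN) are consumed BY NAME.

STATE OF THE ROW.  The T54 capstones (v8 p449794, v9 p488210) prove Thm 5.4 (i) ∧ (ii) at `π₁^temp(𝒢) ⋊^out Π_A`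
MODULO displayed binders, among them Thm 5.4's own `hest : IsTotallyArithEstranged` and the Def 5.1 (i) frame
«branch transport `hBR` without switching».  `hest` is vacuous at edgeless carriers (p487027), FALSE at split
carriers (abc-iut-w6-d072) and at open-kernel actions (abc-iut-w4-d040), TRUE at the abstract `Aff(ℤ_p)` datum
(abc-iut-w6-d064 p440884 — where, however, scaling by `u ∉ 1+pℤ_p` moves `Stab(1)` off its `Π_v`-class: no
transport), and — abc-iut-f-177 p470380 — `{hBR, noSwitchBase, hest}` is JOINTLY UNINHABITED at every Iwahori
loop chart for EVERY outer action, because in `Iw_p = ℤ_p ⋊ (1+pℤ_p)` two branch classes are COMPLEMENTARY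
FACTORS `T_c · T_d = P`, so the two stabilising lifts of `ρ′(a)` re-align to one lift stabilising both branches.

THIS FILE, at the loop graph (ONE vertex, ONE edge, two distinct branches) with `Gtp := G = R ⋊ (U_ℝ × U)`,
`Π_A := U = 1 + πR`, `aug (a, w, u) = u`, `Π_v := piLevel = πR ⋊ (U_ℝ × U)`, `Π_{b₀} := Stab(0)`, `Π_{b₁} := Stab(1)`:
§1 every `Stab(y)` surjects onto `Π_A`; for `y ≠ z`, `Stab(y) ∩ Stab(z) = {(0, w, w⁻¹)}` has image EXACTLY `U_ℝ`
(closed, NOT open: `not_isArithAmple_stab_inf_stab`).  §2 ★ TRANSPORT WITHOUT SWITCHING `exists_transport`: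
every `u ∈ Π_A` has, for EVERY branch point `y`, the lift `((1−u)y, 1, u) ∈ Π_v ∩ Stab(y)` normalising `Π_v` and
`Stab(y)`, while `not_exists_lift_mem_stab_stab`: NO single lift stabilises two branches unless `u ∈ U_ℝ` — the
negation of the Iwahori re-alignment; `translPi_not_mem_closure`: the geometric branch groups `B_0`, `B_1` generate
only REAL translations, so `t_π ∉ ⟨B_0 ∪ B_1⟩ ⊇ B_1·B_0` — NOT complementary factors of the geometric vertex group
`πR ⋊ U_ℝ` (f-177's engine has no fuel; f-177's `hfio` on `Π_A` is not violated — the escape is in the VERTEX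
group).  §3 NON-SPLIT `setOf_central_lift_eq_real`: the `u ∈ Π_A` with a lift in `Π_v` CENTRALISING the geometric
vertex group `Π_v ∩ ker aug` are exactly `U_ℝ` — NOT open (abc-iut-w4-d040's necessary condition met, not dodged),
infinite, proper.  §4 geometric data for stage 2: `B_y = Stab(y) ∩ ker aug = {((1−w)y, w, 1)}` infinite «torus»
point stabilisers with `B_y ∩ B_z = ⊥`.  §5 ★ `exists_decompositionData_loop_transportWitness`: the
`DecompositionData` with Rmk 5.3.1 in full, `hbot`, `hest`; `t54Binders_jointly_inhabited` conjoins §2–§3.  The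
transfer lemma `IsTotallyArithEstranged.of_map` (`ArithTotalEstrangementTransfer.lean`) is the interface by which
stage 2 lifts `hest` from this compact shadow to `π₁^temp(𝓛′) ⋊^out Π_A` of the loop graph of anabelioids `𝓛′` with
vertex `B(πR ⋊ U_ℝ)`, edge `B(U_ℝ)` (`τ ↦ t_1` realises the loop).

HONEST SCOPE: an ABSTRACT-`DecompositionData` witness on a compact shadow (`G` compact; `π₁^temp` of a loop graph is
not — the loop element is the translation `t_1 ∉ Π_v`, as in p440884); chart realisation, the induced outer action,
`hCCt` and the capstone instantiation are stages 2–5 (not claimed).  Nothing here asserts or denies a hypothesis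
of Thm 5.4 for any genuine datum of [SemiAnbd] Ex 5.6; nothing here bears on [IUTchIII] Cor 3.12; witnessed ≠
endorsed; typed ≠ proved.
-/

noncomputable section

namespace Literature.AnabelianGeometry.SemiGraphs

open Topology Filter Set
open Literature.GroupTheory.SpecificGroups
open scoped QuadraticAlgebra




/-! ### §1 The carrier `G = ℤ_p[√p] ⋊ (U_ℝ × U)` in the vocabulary of Def 5.3 -/

variable {p : ℕ} [Fact p.Prime]

namespace QuadAffineWitness

open PadicQuadAffine PadicQuadOneUnits

/-- `conjSubgroup g (Stab y) = Stab(g · y)`. [cite: MochizukiSemiAnbd2006, Def 5.3 (ii), p. 65] -/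
theorem conjSubgroup_stab (g : PadicQuadAffine p) (y : PadicQuad p) :
    conjSubgroup g (stab y) = stab (act g y) :=
  stab_map_conj g y

/-- `conjSubgroup g piLevel = piLevel` (normality). [cite: MochizukiSemiAnbd2006, Def 5.3 (ii), p. 65] -/
theorem conjSubgroup_piLevel (g : PadicQuadAffine p) : conjSubgroup g (piLevel p) = piLevel p := by
  haveI := piLevel_normal (p := p)
  ext k
  simp only [conjSubgroup, Subgroup.mem_map, MulEquiv.coe_toMonoidHom, MulAut.conj_apply]
  constructor
  · rintro ⟨h, hh, rfl⟩
    exact Subgroup.Normal.conj_mem inferInstance h hh g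
  · intro hk
    refine ⟨g⁻¹ * k * g, ?_, by group⟩
    have := Subgroup.Normal.conj_mem inferInstance k hk g⁻¹
    simpa [mul_assoc] using this

/-- The lift `((1 − u) y, 1, u)` of `u ∈ Π_A` centred at the point `y`. [cite: MochizukiSemiAnbd2006, Def 5.1 (i), p. 62] -/
theorem exists_lift_mem_stab (u : PadicQuadOneUnits p) (y : PadicQuad p) :
    ∃ g : PadicQuadAffine p, aug g = u ∧ g ∈ stab y ∧ g ∈ piLevel p ∧ g.w = 1 ∧ g.a = (1 - u.val) * y := by
  refine ⟨⟨(1 - u.val) * y, 1, u, by simp [QuadraticAlgebra.im_one]⟩, rfl, ?_, ?_, rfl, rfl⟩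
  · simp only [mem_stab_iff, act, lin, val_one, one_mul]; ring
  · exact stab_le_piLevel y (by simp only [mem_stab_iff, act, lin, val_one, one_mul]; ring)

/-- **Every branch stabiliser surjects onto `Π_A`**: `Stab(y).map aug = ⊤`. [cite: MochizukiSemiAnbd2006, Rmk 5.3.1, p. 65] -/
theorem map_aug_stab (y : PadicQuad p) : (stab y).map aug = ⊤ :=
  top_le_iff.mp fun u _ => by
    obtain ⟨g, hgu, hgy, -⟩ := exists_lift_mem_stab u y
    exact ⟨g, hgy, hgu⟩

/-- The branch stabilisers are arithmetically ample. [cite: MochizukiSemiAnbd2006, Rmk 5.3.1, p. 65] -/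
theorem isArithAmple_stab (y : PadicQuad p) : IsArithAmple (aug (p := p)) (stab y) := by
  unfold IsArithAmple; rw [map_aug_stab, Subgroup.coe_top]; exact isOpen_univ

/-- The vertex group `piLevel` is arithmetically ample. [cite: MochizukiSemiAnbd2006, Rmk 5.3.1, p. 65] -/
theorem isArithAmple_piLevel : IsArithAmple (aug (p := p)) (piLevel p) := by
  unfold IsArithAmple; rw [map_aug_piLevel, Subgroup.coe_top]; exact isOpen_univ

/-- **Two fixed points force a trivial linear part**: for `y ≠ z`, `g ∈ Stab(y) ∩ Stab(z)` iff `a_g = 0`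
and `lin g = w u = 1` (`(lin g − 1)(y − z) = 0` in the DOMAIN `ℤ_p[√p]`). [cite: MochizukiSemiAnbd2006, Def 5.3 (ii), p. 65] -/
theorem mem_stab_inf_stab_iff {y z : PadicQuad p} (hyz : y ≠ z) (g : PadicQuadAffine p) :
    g ∈ stab y ⊓ stab z ↔ g.a = 0 ∧ g.lin = 1 := by
  simp only [Subgroup.mem_inf, mem_stab_iff, act]
  constructor
  · rintro ⟨hy, hz⟩
    have hl : g.lin = 1 :=
      PadicQuad.eq_one_of_sub_one_mul_eq_zero (c := y - z) (by linear_combination hy - hz) (sub_ne_zero.mpr hyz)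
    refine ⟨?_, hl⟩
    rw [hl, one_mul] at hy
    linear_combination hy
  · rintro ⟨ha, hl⟩
    simp [ha, hl]

/-- `lin g = 1` with `w` real forces `u` real: `w.re · u.im = 0`, `w.re ≠ 0`. [cite: MochizukiSemiAnbd2006, Def 5.3 (ii), p. 65] -/
theorem u_mem_real_of_lin_eq_one {g : PadicQuadAffine p} (h : g.lin = 1) : g.u ∈ real p := by
  have him := congrArg QuadraticAlgebra.im h
  simp only [lin, QuadraticAlgebra.im_mul, g.w_real, zero_mul, add_zero, QuadraticAlgebra.im_one,
    mul_eq_zero, g.w.re_ne_zero, false_or] at him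
  simpa using him

/-- **The image of `Stab(y) ∩ Stab(z)` in `Π_A` is EXACTLY the real line `U_ℝ`** (`y ≠ z`): its elements are
the `(0, w, w⁻¹)`. [cite: MochizukiSemiAnbd2006, Def 5.3 (ii), p. 65] -/
theorem map_aug_stab_inf_stab {y z : PadicQuad p} (hyz : y ≠ z) : (stab y ⊓ stab z).map aug = real p := by
  ext u
  simp only [Subgroup.mem_map]
  constructor
  · rintro ⟨g, hg, rfl⟩
    exact u_mem_real_of_lin_eq_one ((mem_stab_inf_stab_iff hyz g).mp hg).2
  · intro hu
    refine ⟨⟨0, u⁻¹, u, (real p).inv_mem hu⟩, (mem_stab_inf_stab_iff hyz _).mpr ⟨rfl, ?_⟩, rfl⟩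
    simp [lin]

/-- **Def 5.3 (ii) at the carrier**: for `y ≠ z`, `Stab(y) ∩ Stab(z)` is NOT arithmetically ample (its image
`U_ℝ` is closed and not open in `U`). [cite: MochizukiSemiAnbd2006, Def 5.3 (ii), p. 65] -/
theorem not_isArithAmple_stab_inf_stab {y z : PadicQuad p} (hyz : y ≠ z) :
    ¬ IsArithAmple (aug (p := p)) (stab y ⊓ stab z) := by
  unfold IsArithAmple; rw [map_aug_stab_inf_stab hyz]; exact not_isOpen_real

/-! ### §2 Transport without switching vs. no simultaneous transport -/

/-- **BRANCH TRANSPORT WITHOUT SWITCHING (the `hBR`/`noSwitchBase` shape of Def 5.1 (i)).**  Every `u ∈ Π_A`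
and every branch point `y` admit a lift `g ∈ Π_v ∩ Stab(y)` with `aug g = u` which normalises the vertex group
and the branch group: `g Π_v g⁻¹ = Π_v`, `g Stab(y) g⁻¹ = Stab(y)`. [cite: MochizukiSemiAnbd2006, Def 5.1 (i), p. 62] -/
theorem exists_transport (u : PadicQuadOneUnits p) (y : PadicQuad p) :
    ∃ g ∈ piLevel p, aug g = u ∧ g ∈ stab y ∧
      conjSubgroup g (piLevel p) = piLevel p ∧ conjSubgroup g (stab y) = stab y := by
  obtain ⟨g, hgu, hgy, hgv, -⟩ := exists_lift_mem_stab u y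
  refine ⟨g, hgv, hgu, hgy, conjSubgroup_piLevel g, ?_⟩
  rw [conjSubgroup_stab, (mem_stab_iff y g).mp hgy]

/-- **NO SIMULTANEOUS TRANSPORT off the real line** — the exact negation of the Iwahori re-alignment
(abc-iut-f-177 p470380): for `y ≠ z`, a lift of `u` stabilising BOTH `Stab(y)`-point and `Stab(z)`-point exists
only if `u ∈ U_ℝ`. [cite: MochizukiSemiAnbd2006, Def 5.3 (ii), p. 65] -/
theorem mem_real_of_lift_mem_stab_stab {y z : PadicQuad p} (hyz : y ≠ z) {u : PadicQuadOneUnits p}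
    {g : PadicQuadAffine p} (hgu : aug g = u) (hy : g ∈ stab y) (hz : g ∈ stab z) : u ∈ real p := by
  rw [← hgu, ← map_aug_stab_inf_stab hyz]
  exact ⟨g, ⟨hy, hz⟩, rfl⟩

/-- … so for `u ∉ U_ℝ` (e.g. `u = 1 + pᵏ π`) NO lift stabilises two distinct branch points.
[cite: MochizukiSemiAnbd2006, Def 5.3 (ii), p. 65] -/
theorem not_exists_lift_mem_stab_stab {y z : PadicQuad p} (hyz : y ≠ z) {u : PadicQuadOneUnits p}
    (hu : u ∉ real p) : ¬ ∃ g : PadicQuadAffine p, aug g = u ∧ g ∈ stab y ∧ g ∈ stab z :=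
  fun ⟨_, hgu, hy, hz⟩ => hu (mem_real_of_lift_mem_stab_stab hyz hgu hy hz)

/-- Membership in a GEOMETRIC branch group `B_y = Stab(y) ∩ ker aug`: `u = 1` and `a = (1 − w) y` — the
«torus» of real scalings centred at `y`. [cite: MochizukiSemiAnbd2006, Def 5.3 (iii), p. 65] -/
theorem mem_stab_inf_ker_iff (y : PadicQuad p) (g : PadicQuadAffine p) :
    g ∈ stab y ⊓ aug.ker ↔ g.u = 1 ∧ g.a = (1 - g.w.val) * y := by
  simp only [Subgroup.mem_inf, mem_stab_iff, act, MonoidHom.mem_ker, aug_apply, lin]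
  constructor
  · rintro ⟨h, hu⟩
    refine ⟨hu, ?_⟩
    rw [hu, val_one, mul_one] at h
    linear_combination h
  · rintro ⟨hu, ha⟩
    refine ⟨?_, hu⟩
    rw [hu, val_one, mul_one, ha]; ring

/-- The geometric branch groups generate only REAL translations with trivial arithmetic part: every element
of the subgroup generated by `B_y ∪ B_z` for REAL points `y`, `z` (`im = 0`) has `im a = 0` and `u = 1`.
[cite: MochizukiSemiAnbd2006, Def 5.3 (ii), p. 65] -/
theorem closure_geomStab_le {y z : PadicQuad p} (hy : y.im = 0) (hz : z.im = 0) :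
    ∀ g ∈ Subgroup.closure ((stab y ⊓ aug.ker : Subgroup (PadicQuadAffine p)) ∪
      (stab z ⊓ aug.ker : Subgroup (PadicQuadAffine p)) : Set (PadicQuadAffine p)),
      g.a.im = 0 ∧ g.u = 1 := by
  intro g hg
  refine Subgroup.closure_induction (p := fun g _ => g.a.im = 0 ∧ g.u = 1) ?_ ?_ ?_ ?_ hg
  · rintro k (hk | hk)
    · obtain ⟨hu, ha⟩ := (mem_stab_inf_ker_iff y k).mp hk
      exact ⟨by simp [ha, QuadraticAlgebra.im_mul, hy, k.w_real, QuadraticAlgebra.im_one], hu⟩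
    · obtain ⟨hu, ha⟩ := (mem_stab_inf_ker_iff z k).mp hk
      exact ⟨by simp [ha, QuadraticAlgebra.im_mul, hz, k.w_real, QuadraticAlgebra.im_one], hu⟩
  · exact ⟨rfl, rfl⟩
  · rintro k l _ _ ⟨hka, hku⟩ ⟨hla, hlu⟩
    refine ⟨?_, by simp [hku, hlu]⟩
    simp [QuadraticAlgebra.im_mul, lin, hka, hla, hku, k.w_real]
  · rintro k _ ⟨hka, hku⟩
    refine ⟨?_, by simp [hku]⟩
    simp [QuadraticAlgebra.im_mul, QuadraticAlgebra.re_mul, hka, hku, k.w_real, val_inv,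
      QuadraticAlgebra.algebraMap_eq]

/-- The translation `t_π = (π, 1, 1)` by the uniformiser lies in the geometric vertex group `Π_v ∩ ker aug`.
[cite: MochizukiSemiAnbd2006, Def 5.3 (iii), p. 65] -/
theorem translPi_mem : (⟨⟨0, 1⟩, 1, 1, QuadraticAlgebra.im_one⟩ : PadicQuadAffine p) ∈ piLevel p ⊓ aug.ker :=
  ⟨by simp, by simp⟩

/-- **NOT COMPLEMENTARY FACTORS** (the negation of the Iwahori engine `T_c · T_d = P`): the geometric vertex
group element `t_π` is NOT a product `t₁ t₀` with `t₀ ∈ B_0`, `t₁ ∈ B_1` — indeed it is not even in the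
subgroup they generate. [cite: MochizukiSemiAnbd2006, Def 5.3 (ii), p. 65] -/
theorem translPi_not_mem_closure :
    (⟨⟨0, 1⟩, 1, 1, QuadraticAlgebra.im_one⟩ : PadicQuadAffine p) ∉
      Subgroup.closure ((stab 0 ⊓ aug.ker : Subgroup (PadicQuadAffine p)) ∪
        (stab 1 ⊓ aug.ker : Subgroup (PadicQuadAffine p)) : Set (PadicQuadAffine p)) := by
  intro h
  have := (closure_geomStab_le (p := p) (y := 0) (z := 1) rfl QuadraticAlgebra.im_one _ h).1
  simp at this

/-! ### §3 NON-SPLIT: the kernel of the outer action is the real line `U_ℝ`, which is not open -/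

/-- **NON-SPLIT.**  The `u ∈ Π_A` admitting a lift in the vertex group which CENTRALISES the geometric vertex
group `Π_v ∩ ker aug = πR ⋊ U_ℝ` are exactly the real principal units `U_ℝ`: testing against the translation
`t_π` forces `lin = 1`, testing against the real scaling `1 + p` forces `a = 0`; conversely `(0, u⁻¹, u)`
acts trivially on `R`. [cite: MochizukiSemiAnbd2006, Def 5.1 (i), p. 62] -/
theorem setOf_central_lift_eq_real :
    {u : PadicQuadOneUnits p | ∃ g ∈ piLevel p, aug g = u ∧
      ∀ k ∈ piLevel p ⊓ aug.ker, g * k = k * g} = (real p : Set (PadicQuadOneUnits p)) := by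
  ext u
  simp only [mem_setOf_eq, SetLike.mem_coe]
  constructor
  · rintro ⟨g, -, rfl, hcomm⟩
    -- test against `t_π`: `lin g · π = π`
    have h1 := congrArg PadicQuadAffine.a (hcomm _ translPi_mem)
    simp only [mul_a, lin, val_one, mul_one, one_mul] at h1
    have hl : g.lin = 1 := by
      refine PadicQuad.eq_one_of_sub_one_mul_eq_zero (c := ⟨0, 1⟩) ?_ (by simp [QuadraticAlgebra.ext_iff])
      simp only [lin]; linear_combination h1
    exact u_mem_real_of_lin_eq_one hl
  · intro hu
    refine ⟨⟨0, u⁻¹, u, (real p).inv_mem hu⟩, by simp, rfl, ?_⟩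
    intro k hk
    have hk : k.u = 1 := (Subgroup.mem_inf.mp hk).2
    ext1
    · simp [lin, hk]
    · exact mul_comm _ _
    · simp [hk]

/-- **The kernel of the outer action is NOT open** (abc-iut-w4-d040's necessary condition for `hest` is met,
not dodged) and is infinite and proper. [cite: MochizukiSemiAnbd2006, Def 5.1 (i), p. 62] -/
theorem not_isOpen_setOf_central_lift :
    ¬ IsOpen {u : PadicQuadOneUnits p | ∃ g ∈ piLevel p, aug g = u ∧
      ∀ k ∈ piLevel p ⊓ aug.ker, g * k = k * g} ∧
    {u : PadicQuadOneUnits p | ∃ g ∈ piLevel p, aug g = u ∧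
      ∀ k ∈ piLevel p ⊓ aug.ker, g * k = k * g}.Infinite ∧
    {u : PadicQuadOneUnits p | ∃ g ∈ piLevel p, aug g = u ∧
      ∀ k ∈ piLevel p ⊓ aug.ker, g * k = k * g} ≠ univ := by
  rw [setOf_central_lift_eq_real]
  refine ⟨not_isOpen_real, real_infinite, fun h => imPow_not_mem_real (p := p) 1 ?_⟩
  have : imPow (p := p) 1 ∈ (univ : Set (PadicQuadOneUnits p)) := mem_univ _
  rw [← h] at this
  exact this

/-! ### §4 Geometric data for stage 2 -/

/-- The geometric branch groups of distinct points meet trivially: `B_y ∩ B_z = ⊥` (`y ≠ z`) — in particular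
`B_y ∩ g B_y g⁻¹ = ⊥` for `g ∉ Stab(y)` (malnormality in the point directions). [cite: MochizukiSemiAnbd2006, Def 5.3 (ii), p. 65] -/
theorem stab_inf_ker_inf_eq_bot {y z : PadicQuad p} (hyz : y ≠ z) :
    (stab y ⊓ aug.ker) ⊓ (stab z ⊓ aug.ker) = (⊥ : Subgroup (PadicQuadAffine p)) := by
  rw [eq_bot_iff]
  intro g hg
  have hy : g ∈ stab y := (Subgroup.mem_inf.mp (Subgroup.mem_inf.mp hg).1).1
  have hu : g.u = 1 := (Subgroup.mem_inf.mp (Subgroup.mem_inf.mp hg).1).2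
  have hz : g ∈ stab z := (Subgroup.mem_inf.mp (Subgroup.mem_inf.mp hg).2).1
  obtain ⟨ha, hl⟩ := (mem_stab_inf_stab_iff hyz g).mp ⟨hy, hz⟩
  have hw : g.w = 1 := by
    apply PadicQuadOneUnits.ext
    simpa [lin, hu] using hl
  rw [Subgroup.mem_bot]
  ext1
  · exact ha
  · exact hw
  · exact hu

/-- The geometric branch groups are infinite: `((1 − wₖ) y, wₖ, 1) ∈ B_y` for the pairwise distinct real units
`wₖ = 1 + pᵏ⁺¹`. [cite: MochizukiSemiAnbd2006, Def 5.3 (iii), p. 65] -/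
theorem stab_inf_ker_infinite (y : PadicQuad p) :
    ((stab y ⊓ aug.ker : Subgroup (PadicQuadAffine p)) : Set (PadicQuadAffine p)).Infinite := by
  have hinj : Function.Injective fun k : ℕ =>
      (⟨(1 - (realPow k).val) * y, realPow k, 1, realPow_mem_real k⟩ : PadicQuadAffine p) := by
    intro j k h
    exact realPow_injective (congrArg PadicQuadAffine.w h)
  refine Set.infinite_of_injective_forall_mem hinj fun k => ?_
  exact (mem_stab_inf_ker_iff y _).mpr ⟨rfl, rfl⟩

/-! ### §5 The decomposition datum on the LOOP graph and the joint witness -/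

variable (p) in
/-- **Joint witness on the loop graph.**  On the semi-graph with ONE vertex and ONE edge both of whose (distinct)
branches abut to the vertex, the decomposition datum `Π_v = piLevel = πR ⋊ (U_ℝ × U)`, `Π_{b₀} = Stab(0)`,
`Π_{b₁} = Stab(1)` in `G = R ⋊ (U_ℝ × U)` with augmentation `aug` satisfies: Rmk 5.3.1 in full (every
verticial and every edge-like subgroup is compact and arithmetically ample), Thm 5.4's `hbot`, and Thm 5.4's
hypothesis `hest : IsTotallyArithEstranged`. [cite: MochizukiSemiAnbd2006, Thm 5.4, p. 66] -/
theorem exists_decompositionData_loop_transportWitness :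
    ∃ D : DecompositionData (PadicQuadAffine p) Unit Bool,
      (∀ b b' : Bool, D.edgeOf b = D.edgeOf b') ∧ (∀ b : Bool, D.abut b = some ()) ∧
      D.vertGp () = piLevel p ∧ D.brGp false = stab 0 ∧ D.brGp true = stab 1 ∧
      VerticialEdgeLikeCompactAmpleStatement D aug ∧
      ¬ IsArithAmple (aug (p := p)) (⊥ : Subgroup (PadicQuadAffine p)) ∧
      IsTotallyArithEstranged D aug := by
  let pt : Bool → PadicQuad p := fun b => if b then 1 else 0
  let D : DecompositionData (PadicQuadAffine p) Unit Bool :=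
    { E := Unit, edgeOf := fun _ => (), abut := fun _ => some (), vertGp := fun _ => piLevel p,
      brGp := fun b => stab (pt b), brGp_le_vertGp := fun b _ _ => stab_le_piLevel (pt b) }
  have hpt0 : pt false = 0 := rfl
  have hpt1 : pt true = 1 := rfl
  have hptne : ∀ b b' : Bool, b' ≠ b → pt b ≠ pt b' := by
    rintro (_ | _) (_ | _) h <;> simp_all [pt]
  have hest : IsTotallyArithEstranged D aug := by
    intro e b _ v _ g hg
    change g ∈ piLevel p at hg
    refine ⟨fun b' _ hne => ?_, fun hgb => ?_⟩
    · change ¬ IsArithAmple aug (stab (pt b) ⊓ conjSubgroup g (stab (pt b')))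
      rw [conjSubgroup_stab]
      refine not_isArithAmple_stab_inf_stab ?_
      rcases b with _ | _ <;> rcases b' with _ | _
      · exact absurd rfl hne
      · rw [hpt0, hpt1]; exact (act_one_ne_zero hg).symm
      · rw [hpt0, hpt1]; exact (act_zero_ne_one hg).symm
      · exact absurd rfl hne
    · change g ∉ stab (pt b) at hgb
      change ¬ IsArithAmple aug (stab (pt b) ⊓ conjSubgroup g (stab (pt b)))
      rw [conjSubgroup_stab]
      exact not_isArithAmple_stab_inf_stab fun h => hgb ((mem_stab_iff _ _).mpr h.symm)
  refine ⟨D, fun _ _ => rfl, fun _ => rfl, rfl, rfl, rfl, ?_, ?_, hest⟩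
  · rintro K (⟨v, g, rfl⟩ | ⟨b, g, rfl⟩)
    · change IsCompact ((conjSubgroup g (piLevel p) : Subgroup (PadicQuadAffine p)) : Set (PadicQuadAffine p)) ∧
        IsArithAmple aug (conjSubgroup g (piLevel p))
      rw [conjSubgroup_piLevel]
      exact ⟨isCompact_piLevel, isArithAmple_piLevel⟩
    · change IsCompact ((conjSubgroup g (stab (pt b)) : Subgroup (PadicQuadAffine p)) : Set (PadicQuadAffine p)) ∧
        IsArithAmple aug (conjSubgroup g (stab (pt b)))
      rw [conjSubgroup_stab]
      exact ⟨isCompact_stab _, isArithAmple_stab _⟩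
  · exact hest.not_isArithAmple_bot false () rfl (Or.inr ⟨true, rfl, by decide⟩)

variable (p) in
/-- **`{hest, transport-without-switching, non-split}` JOINTLY INHABITED WITH AN EDGE** — the one-line record
for the T54 board: the decomposition datum of `exists_decompositionData_loop_transportWitness` (Rmk 5.3.1,
`hbot`, `hest`) TOGETHER WITH (T) transport of the vertex group and of EACH branch group by a lift of every
`u ∈ Π_A` fixing the branch (Def 5.1 (i) shape, no switching), (N) the kernel of the outer action on the
geometric vertex group is the non-open real line `U_ℝ`, and (E) `Π_A` infinite compact.  Contrast: at every
Iwahori loop chart these are jointly uninhabited (abc-iut-f-177 p470380).  A witness at OUR abstract carrier,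
not a statement about [SemiAnbd] Ex 5.6 in print. [cite: MochizukiSemiAnbd2006, Thm 5.4, p. 66] -/
theorem t54Binders_jointly_inhabited :
    (∃ D : DecompositionData (PadicQuadAffine p) Unit Bool,
      (∀ b b' : Bool, D.edgeOf b = D.edgeOf b') ∧ (∀ b : Bool, D.abut b = some ()) ∧
      D.vertGp () = piLevel p ∧ D.brGp false = stab 0 ∧ D.brGp true = stab 1 ∧
      VerticialEdgeLikeCompactAmpleStatement D aug ∧
      ¬ IsArithAmple (aug (p := p)) (⊥ : Subgroup (PadicQuadAffine p)) ∧
      IsTotallyArithEstranged D aug) ∧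
    (∀ (u : PadicQuadOneUnits p) (y : PadicQuad p), ∃ g ∈ piLevel p, aug g = u ∧ g ∈ stab y ∧
      conjSubgroup g (piLevel p) = piLevel p ∧ conjSubgroup g (stab y) = stab y) ∧
    (∀ u : PadicQuadOneUnits p, u ∉ real p →
      ¬ ∃ g : PadicQuadAffine p, aug g = u ∧ g ∈ stab 0 ∧ g ∈ stab 1) ∧
    ({u : PadicQuadOneUnits p | ∃ g ∈ piLevel p, aug g = u ∧
      ∀ k ∈ piLevel p ⊓ aug.ker, g * k = k * g} = (real p : Set (PadicQuadOneUnits p)) ∧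
      ¬ IsOpen (real p : Set (PadicQuadOneUnits p))) ∧
    (Continuous (aug (p := p)) ∧ Function.Surjective (aug (p := p)) ∧
      CompactSpace (PadicQuadOneUnits p) ∧ Infinite (PadicQuadOneUnits p)) :=
  ⟨exists_decompositionData_loop_transportWitness p, exists_transport,
    fun _ hu => not_exists_lift_mem_stab_stab zero_ne_one hu,
    ⟨setOf_central_lift_eq_real, not_isOpen_real⟩,
    ⟨continuous_aug, aug_surjective, inferInstance, inferInstance⟩⟩

end QuadAffineWitness

end Literature.AnabelianGeometry.SemiGraphs
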